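import Mathlib
import HarnessLib
import Literature.NumberTheory.Transcendental.KZKernelConjectureForms
import Summits.KontsevichZagierPeriods.KontsevichZagierPeriods.Theses.LinRedNormalForm

/-!
# Route LinRedNormalForm, item `ResidualBeyondGenusZero` (stmt-KontsevichZagierPeriods-3917): equivalent forms of the declared residual

The support item `ResidualBeyondGenusZero` of route LinRedNormalForm — "every vanishing formal
`ℤ`-combination of integral representations is congruent modulo `KZ.relations` to a
`ℤ`-combination of genus-zero representations" — is the route's DECLARED RESIDUAL (summit-strength:
see `LinRedNormalFormResidualBeyondGenusZeroStrength.lean`, which proves `KontsevichZagierPeriods →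
ResidualBeyondGenusZero` and, granted the sector cruxes, the converse). This file records,
sorry-free and unconditionally, three equivalent readings of the residual, so that the planner can
restate it in whichever shape the assembly needs and so that a refuter knows exactly what a
refutation must produce:

* `residualBeyondGenusZero_iff_ker_le_sup` — LATTICE FORM: `ker eval ≤ relations ⊔ ⟨genus-zero⟩`,
  i.e. the cokernel `ker eval ⧸ relations` of the calculus (the obstruction group of Conjecture 1)
  is generated by classes of genus-zero combinations;
* `residualBeyondGenusZero_iff_sub_of`, `residualBeyondGenusZero_iff_isRational` —
  TWO-REPRESENTATION FORMS: any two integral representations of the same real number (all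
  `ℚ`-semialgebraic data, resp. of KZ's literal rational shape `KZ.IntegralRep.IsRational`, exactly
  the endpoints of the summit statement) differ, modulo the moves, by a `ℤ`-combination of genus-zero
  representations — Conjecture 1 of Kontsevich–Zagier "with a genus-zero error term"; the
  bookkeeping is `KZ.exists_integralRep_sub` and `KZ.exists_isRational_equivalent` (both discharged
  in `KZCalculusProofs.lean`), as for the kernel form of the conjecture
  (`kzKernelConjecture_iff_isRational`);
* `residualBeyondGenusZero_iff_invariant` — OBSTRUCTION FORM: every additive invariant
  `ι : KZ.FormalRep →+ A` that vanishes on the four move sets and on the genus-zero representations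
  vanishes on `ker eval` (equivalently, factors through the value). A refutation of the residual —
  which by `residualBeyondGenusZero_of_kontsevichZagierPeriods` would refute the summit — is
  therefore exactly such an invariant together with a vanishing combination it does not kill
  (route LinRedNormalForm, kill criterion (1); route Neg, `NegObstructionShape`).

References: M. Kontsevich, D. Zagier, *Periods* (2001), §1.2, Conjecture 1; A. Huber,
S. Müller-Stach, *Periods and Nori Motives* (2017), Conj. 13.2.1 and Rem. 13.2.2 (kernel /
injectivity form).
-/

noncomputable section

namespace Summit.KontsevichZagierPeriods.ResidualBeyondGenusZero

open Literature.NumberTheory.Transcendental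
open Summit.KontsevichZagierPeriods.KontsevichZagierPeriods.Theses.LinRedNormalForm

/-- **Lattice form.** `ResidualBeyondGenusZero` holds if and only if
`ker eval ≤ relations ⊔ closure (genus-zero representations)` in the lattice of subgroups of
`KZ.FormalRep`: (⇒) for `eval c = 0` write `c = (c - c₀) + c₀`; (⇐) `AddSubgroup.mem_sup` splits
`c = y + z` with `y ∈ relations`, `z` in the closure, and `c - z = y`. Since
`relations ≤ ker eval` (soundness, `KZ.relations_le_ker_eval_holds`), this says that the
obstruction group `ker eval ⧸ relations` of Conjecture 1 is generated by genus-zero classes.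
[folklore] -/
theorem residualBeyondGenusZero_iff_ker_le_sup :
    ResidualBeyondGenusZero ↔
      KZ.eval.ker ≤ KZ.relations ⊔ AddSubgroup.closure
        {x : KZ.FormalRep | ∃ (k : ℕ) (r : KZ.IntegralRep k)
          (p : MvPolynomial (Fin k) ℚ) (a : Fin k → Fin k → ℕ) (b c : Fin k → ℕ),
          r.domain = {t | (∀ i, 0 < t i) ∧ (∀ i, t i < 1) ∧ StrictAnti t} ∧
          Set.EqOn r.integrand (fun t => MvPolynomial.aeval t p / ((∏ i, t i ^ b i) *
            (∏ i, (1 - t i) ^ c i) * ∏ i, ∏ j, if i < j then (t i - t j) ^ a i j else 1))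
            r.domain ∧ x = KZ.of r} := by
  constructor
  · intro hRES c hc
    obtain ⟨c₀, hc₀, hcc₀⟩ := hRES c ((AddMonoidHom.mem_ker).1 hc)
    exact AddSubgroup.mem_sup.2 ⟨c - c₀, hcc₀, c₀, hc₀, sub_add_cancel c c₀⟩
  · intro hle c hc
    obtain ⟨y, hy, z, hz, hyz⟩ := AddSubgroup.mem_sup.1 (hle ((AddMonoidHom.mem_ker).2 hc))
    refine ⟨z, hz, ?_⟩
    rwa [← hyz, add_sub_cancel_right]

/-- **Two-representation form (algebraic endpoints).** `ResidualBeyondGenusZero` holds if and only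
if any two integral representations (with `ℚ`-semialgebraic data, in any dimensions) of the same
real number differ modulo the moves by a `ℤ`-combination of genus-zero representations. (⇒): apply
the residual to `c = [r] - [r']`, `eval c = r.value - r'.value = 0`. (⇐): every formal combination
is `c ≡ [r] - [r']` modulo relations (`KZ.exists_integralRep_sub_holds`); soundness
(`KZ.relations_le_ker_eval_holds`) gives `r.value = r'.value` when `eval c = 0`, and
`c - c₀ = (c - ([r] - [r'])) + ([r] - [r'] - c₀)`. This is Conjecture 1 of Kontsevich–Zagier 2001,
§1.2, in its two-representation shape, weakened by a genus-zero error term. [folklore] -/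
theorem residualBeyondGenusZero_iff_sub_of :
    ResidualBeyondGenusZero ↔
      ∀ ⦃n m : ℕ⦄ (r : KZ.IntegralRep n) (r' : KZ.IntegralRep m), r.value = r'.value →
        ∃ c₀ ∈ AddSubgroup.closure
          {x : KZ.FormalRep | ∃ (k : ℕ) (r : KZ.IntegralRep k)
            (p : MvPolynomial (Fin k) ℚ) (a : Fin k → Fin k → ℕ) (b c : Fin k → ℕ),
            r.domain = {t | (∀ i, 0 < t i) ∧ (∀ i, t i < 1) ∧ StrictAnti t} ∧
            Set.EqOn r.integrand (fun t => MvPolynomial.aeval t p / ((∏ i, t i ^ b i) *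
              (∏ i, (1 - t i) ^ c i) * ∏ i, ∏ j, if i < j then (t i - t j) ^ a i j else 1))
              r.domain ∧ x = KZ.of r},
          KZ.of r - KZ.of r' - c₀ ∈ KZ.relations := by
  constructor
  · intro hRES n m r r' hv
    apply hRES
    rw [KZ.eval_of_sub_of, hv, sub_self]
  · intro h c hc
    obtain ⟨n, m, r, r', hrel⟩ := KZ.exists_integralRep_sub_holds c
    have hker : KZ.eval (c - (KZ.of r - KZ.of r')) = 0 := KZ.relations_le_ker_eval_holds hrel
    rw [map_sub, hc, zero_sub, neg_eq_zero, KZ.eval_of_sub_of, sub_eq_zero] at hker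
    obtain ⟨c₀, hc₀, hrr⟩ := h r r' hker
    refine ⟨c₀, hc₀, ?_⟩
    have key := add_mem hrel hrr
    rwa [sub_add_sub_cancel] at key

/-- **Two-representation form (KZ-literal rational endpoints).** `ResidualBeyondGenusZero` holds
if and only if any two integral representations OF THE SHAPE OF THE §1.1 DEFINITION (integrand a
quotient of `ℚ`-polynomials, `KZ.IntegralRep.IsRational` — verbatim the endpoints of the summit
statement `KontsevichZagierPeriods`) with the same value differ modulo the moves by a
`ℤ`-combination of genus-zero representations. Reduction to `residualBeyondGenusZero_iff_sub_of`:
every representation is equivalent to a rational-shape one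
(`KZ.exists_isRational_equivalent_holds`, KZ §1.1, remark after the Definition), equivalent
representations have equal values (`KZ.Equivalent.value_eq_holds`), and
`[r] - [r'] - c₀ = ([r] - [R]) + ([R] - [R'] - c₀) + ([R'] - [r'])`. So the item is exactly "the
summit statement with a genus-zero error term". [folklore] -/
theorem residualBeyondGenusZero_iff_isRational :
    ResidualBeyondGenusZero ↔
      ∀ ⦃n m : ℕ⦄ (r : KZ.IntegralRep n) (r' : KZ.IntegralRep m),
        r.IsRational → r'.IsRational → r.value = r'.value →
        ∃ c₀ ∈ AddSubgroup.closure
          {x : KZ.FormalRep | ∃ (k : ℕ) (r : KZ.IntegralRep k)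
            (p : MvPolynomial (Fin k) ℚ) (a : Fin k → Fin k → ℕ) (b c : Fin k → ℕ),
            r.domain = {t | (∀ i, 0 < t i) ∧ (∀ i, t i < 1) ∧ StrictAnti t} ∧
            Set.EqOn r.integrand (fun t => MvPolynomial.aeval t p / ((∏ i, t i ^ b i) *
              (∏ i, (1 - t i) ^ c i) * ∏ i, ∏ j, if i < j then (t i - t j) ^ a i j else 1))
              r.domain ∧ x = KZ.of r},
          KZ.of r - KZ.of r' - c₀ ∈ KZ.relations := by
  rw [residualBeyondGenusZero_iff_sub_of]
  constructor
  · intro h n m r r' _ _ hv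
    exact h r r' hv
  · intro h n m r r' hv
    obtain ⟨N, R, hR, hrR⟩ := KZ.exists_isRational_equivalent_holds r
    obtain ⟨N', R', hR', hrR'⟩ := KZ.exists_isRational_equivalent_holds r'
    have hvR : R.value = R'.value := by
      rw [← KZ.Equivalent.value_eq_holds hrR, ← KZ.Equivalent.value_eq_holds hrR', hv]
    obtain ⟨c₀, hc₀, hRR⟩ := h R R' hR hR' hvR
    refine ⟨c₀, hc₀, ?_⟩
    have h₁ : KZ.of r - KZ.of R ∈ KZ.relations := hrR
    have h₂ : KZ.of R' - KZ.of r' ∈ KZ.relations := hrR'.symm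
    have key := add_mem (add_mem h₁ hRR) h₂
    rwa [show KZ.of r - KZ.of R + (KZ.of R - KZ.of R' - c₀) + (KZ.of R' - KZ.of r') =
      KZ.of r - KZ.of r' - c₀ by abel] at key

/-- **Invariants detect membership in `R ⊔ closure S`** (abstract form of the obstruction
criterion). For subgroups `K`, `R` of an abelian group `M` and a subset `S`,
`K ≤ R ⊔ closure S` if and only if every additive map `ι : M →+ A` killing `R` and `S` kills `K`:
(⇒) `ι.ker` is a subgroup containing `R` and `closure S` (`AddSubgroup.closure_le`, `sup_le`);
(⇐) take the projection `M →+ M ⧸ (R ⊔ closure S)`, whose kernel is `R ⊔ closure S`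
(`QuotientAddGroup.ker_mk'`). [folklore] -/
theorem le_sup_closure_iff_forall_addMonoidHom {M : Type} [AddCommGroup M]
    (K R : AddSubgroup M) (S : Set M) :
    K ≤ R ⊔ AddSubgroup.closure S ↔
      ∀ (A : Type) [AddCommGroup A] (ι : M →+ A), R ≤ ι.ker → S ⊆ ι.ker → K ≤ ι.ker := by
  constructor
  · intro hle A _ ι hR hS
    exact hle.trans (sup_le hR ((AddSubgroup.closure_le _).2 hS))
  · intro h
    set N : AddSubgroup M := R ⊔ AddSubgroup.closure S
    have hker : (QuotientAddGroup.mk' N).ker = N := QuotientAddGroup.ker_mk' N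
    have h₁ : R ≤ (QuotientAddGroup.mk' N).ker := by
      rw [hker]
      exact le_sup_left
    have h₂ : S ⊆ (QuotientAddGroup.mk' N).ker := by
      rw [hker]
      exact AddSubgroup.subset_closure.trans (SetLike.coe_subset_coe.2 le_sup_right)
    have key := h (M ⧸ N) (QuotientAddGroup.mk' N) h₁ h₂
    rwa [hker] at key

/-- **Obstruction form.** `ResidualBeyondGenusZero` holds if and only if every additive invariant
`ι : KZ.FormalRep →+ A` (any abelian group `A`) which vanishes on the relations of the calculus and
on every genus-zero representation vanishes on all of `ker eval` — i.e. is a function of the value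
alone on vanishing combinations (`residualBeyondGenusZero_iff_ker_le_sup` +
`le_sup_closure_iff_forall_addMonoidHom`). Consequently a refutation of the item (and with it of
the summit, `residualBeyondGenusZero_of_kontsevichZagierPeriods`) is the same thing as an additive
move-invariant killing the genus-zero representations together with a vanishing combination it
does not kill (route LinRedNormalForm, kill criterion (1); route Neg, `NegObstructionShape`).
[folklore] -/
theorem residualBeyondGenusZero_iff_invariant :
    ResidualBeyondGenusZero ↔
      ∀ (A : Type) [AddCommGroup A] (ι : KZ.FormalRep →+ A),
        KZ.relations ≤ ι.ker →
        {x : KZ.FormalRep | ∃ (k : ℕ) (r : KZ.IntegralRep k)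
            (p : MvPolynomial (Fin k) ℚ) (a : Fin k → Fin k → ℕ) (b c : Fin k → ℕ),
            r.domain = {t | (∀ i, 0 < t i) ∧ (∀ i, t i < 1) ∧ StrictAnti t} ∧
            Set.EqOn r.integrand (fun t => MvPolynomial.aeval t p / ((∏ i, t i ^ b i) *
              (∏ i, (1 - t i) ^ c i) * ∏ i, ∏ j, if i < j then (t i - t j) ^ a i j else 1))
              r.domain ∧ x = KZ.of r} ⊆ ι.ker →
        KZ.eval.ker ≤ ι.ker :=
  residualBeyondGenusZero_iff_ker_le_sup.trans (le_sup_closure_iff_forall_addMonoidHom _ _ _)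

end Summit.KontsevichZagierPeriods.ResidualBeyondGenusZero
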